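import Summits.KontsevichZagierPeriods.Zeta5Search.SymRayWedgeDictionary
import Summits.KontsevichZagierPeriods.Zeta5Search.WedgeDictionaryIntegralPartPQ
import Summits.KontsevichZagierPeriods.Zeta5Search.PermutationSaving
import Literature.NumberTheory.Irrationality.BrownZudilin2022.TotallySymmetricDecomposition
import HarnessLib

/-!
# The whole wedge dictionary — `Q`, `P̂` AND `P` — on the diagonal `a = n·1⁸`, from Brown–Zudilin Sect. 2 (cell `pub-zeta5`, gen-1 g12)

HONEST FRAMING: systematic search; no irrationality claim unless certified.

OUR work (Summit side), D2 lane. The cell's conjecture `explicitPQ` (`WedgeDictionaryIntegralPartPQ`, equivalent to `wedgeDictionary`)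
says: `I(a) = Q(a)(2ζ(5) + 4ζ(3)ζ(2)) − 4ρ(a)(UV′ − U′V)ζ(2) − 2ρ(a)(W′V − WV′)` with `b = b(a)`, `b′ = b + e_j` and `U, W, V` the canonical
coefficients of `F̃₇ = Uζ(5) + Wζ(3) − V`. Its `Q`-part is PROVED in general (`wedgeDictionary_Q`); its `P̂`-part is reduced to printed
identities on large sub-regions (`WedgeDictionaryDescent22*`); for its `P`-part the source prints NO formula for `P(a)` (arXiv:2210.03391,
Remark 1). Here we settle ALL THREE PARTS on the whole diagonal `a = n·1⁸ = (n,…,n)` (`b = (3n; n⁷)`, partner `j = 1`), for every `n`,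
from exactly two PUBLISHED named facts of [BrownZudilin2022, Sect. 2] typed in
`Literature/…/BrownZudilin2022/TotallySymmetricDecomposition.lean`:
`I_solvesRec` (Koutschan's third-order recursion for the INTEGRALS `I_n`) and `I_init` (the values `I₀, I₁, I₂`), which give the
decomposition (5) `I_n = Q_n(2ζ(5)+4ζ(3)ζ(2)) − 4P̂_nζ(2) − 2P_n` for all `n` (`symmetricDecomposition`, PROVED there) — combined with the
cell's kernel theorems `bz_Q_ray`, `bz_Phat_ray`, `bz_P_ray` (`SymRayZudilin15`: BZ's `Q_n, P̂_n, P_n` ARE the three wedge minors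
`ρ_n(UW′ − U′W)`, `ρ_n(UV′ − U′V)`, `ρ_n(VW′ − V′W)` on the ray, all `n`), `QOf_diag`, `rhoOf_diag`, `bOfA_diag` (`SymRayWedgeDictionary`)
and `vwp_decomposition` (`WedgeDictionary`):

* `cellularIntegral_diag_minors` — `I(n·1⁸) = ρ_n·[(UW′ − U′W)(2ζ(5) + 4ζ(3)ζ(2)) − 4(UV′ − U′V)ζ(2) − 2(VW′ − V′W)]`,
  `ρ_n = (−1)ⁿ n!¹⁰/(4(2n)!)`: the vector `(Q, P̂, P)(n·1⁸)` is `ρ_n · r(b_n) × r(b′_n)` with `r = (U, W, V)` — INCLUDING the `P`-coordinate;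
* `explicitPQ_diag` — the conclusion of `explicitPQ` at `a = n·1⁸`, `j = 1`, literally, for every `n`;
* `wedgeDictionary_diag` — both conjuncts of the conclusion of `wedgeDictionary` at `a = n·1⁸`, `j = 1`, literally, for every `n`:
  `I(n·1⁸) = 2ρ_n·[(W(b′) − 2ζ(2)U(b′))·F̃₇(b) − (W(b) − 2ζ(2)U(b))·F̃₇(b′)]`.
* `explicitPQ_diag_allj`, `explicitPQ_restricted_to_diag` — the same for EVERY partner `j ∈ [1,7]`: on the diagonal `b + e_j` is a
  relabelling of the lower slots of `b + e₁` (`update_bRay_eq_permLower`) and `U, W, V` are relabelling-invariant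
  (`SymmetricGauge.coeffU/W/V_permLower`, file `PermutationSaving`, PROVED in the tree); so the conjecture `explicitPQ` RESTRICTED TO THE
  DIAGONAL `{n·1⁸ : n ∈ ℕ}` (all `n`, all `j`, its hypotheses dropped) follows from the two named facts.

This is the first kernel-certified infinite family for the `P`-part of the dictionary (previously: no instance at all — the `P`-part
has no printed handle off the diagonal). It is CONDITIONAL on the two named facts exactly as printed (a computer proof in the source,
details omitted there, Sect. 1); nothing here is evidence for `explicitPQ` off the diagonal, and nothing is an arithmetic claim.
-/

noncomputable section

open Finset

namespace Summit.KontsevichZagierPeriods.Zeta5Search.SymRay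

open Summit.KontsevichZagierPeriods.Zeta5Search.WedgeDictionary
open Summit.KontsevichZagierPeriods.Zeta5Search.SymmetricGauge (permLower coeffU_permLower coeffW_permLower coeffV_permLower)
open Literature.NumberTheory.Irrationality
open Literature.NumberTheory.Irrationality.BrownZudilin2022 (vwpDual bOfA cellularIntegral QOf I_solvesRec I_init Isym zeta5hat
  symmetricDecomposition)
open Literature.NumberTheory.Transcendental (zetaValue)

/-- `I(n·1⁸)` is the totally symmetric integral `I_n` of Sect. 2 (definitional). -/
theorem cellularIntegral_aDiag (n : ℕ) : cellularIntegral (aDiag n) = Isym n := rfl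

/-- **`(Q, P̂, P)(n·1⁸) = ρ_n · r(b_n) × r(b′_n)`, integral form**: for every `n`,
`I(n·1⁸) = ρ_n·[(U W′ − U′ W)(2ζ(5) + 4ζ(3)ζ(2)) − 4(U V′ − U′ V)ζ(2) − 2(V W′ − V′ W)]` with `ρ_n = (−1)ⁿ n!¹⁰/(4(2n)!)`,
`(U, W, V) = (coeffU, coeffW, coeffV)(bRay n)`, primes at `bRay' n = bRay n + e₁` — conditional on the two named facts of
[BrownZudilin2022, Sect. 2] (`I_solvesRec`, `I_init`). -/
theorem cellularIntegral_diag_minors (hrec : I_solvesRec) (hinit : I_init) (n : ℕ) :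
    cellularIntegral (aDiag n) =
      ((-1) ^ n * (n.factorial : ℝ) ^ 10 / (4 * ((2 * n).factorial : ℝ))) *
        (((coeffU (bRay n) : ℝ) * coeffW (bRay' n) - coeffU (bRay' n) * coeffW (bRay n)) *
            (2 * zetaValue 5 + 4 * zetaValue 3 * zetaValue 2) -
          4 * ((coeffU (bRay n) : ℝ) * coeffV (bRay' n) - coeffU (bRay' n) * coeffV (bRay n)) * zetaValue 2 -
          2 * ((coeffV (bRay n) : ℝ) * coeffW (bRay' n) - coeffV (bRay' n) * coeffW (bRay n))) := by
  rw [cellularIntegral_aDiag, symmetricDecomposition hrec hinit n, zeta5hat, ← SymmetricRecursion.Q_eq_Qsol n,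
    bz_Phat_ray, bz_P_ray]
  have hQ := congrArg (fun q : ℚ => (q : ℝ)) (bz_Q_ray n)
  push_cast at hQ ⊢
  linear_combination (2 * zetaValue 5 + 4 * zetaValue 3 * zetaValue 2) * hQ

/-- **The conclusion of `explicitPQ` on the whole diagonal** (`a = n·1⁸`, partner `j = 1`), literally, for every `n`:
`I(a) = Q(a)(2ζ(5) + 4ζ(3)ζ(2)) − 4ρ(a)(U(b)V(b′) − U(b′)V(b))ζ(2) − 2ρ(a)(W(b′)V(b) − W(b)V(b′))`, `b = b(a)`, `b′ = b + e₁` —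
all three parts `Q`, `P̂`, `P`; conditional on the two named facts of [BrownZudilin2022, Sect. 2]. -/
theorem explicitPQ_diag (hrec : I_solvesRec) (hinit : I_init) (n : ℕ) :
    cellularIntegral (aDiag n) =
      (QOf (aDiag n) : ℝ) * (2 * zetaValue 5 + 4 * zetaValue 3 * zetaValue 2) -
        4 * ((rhoOf (aDiag n) *
              (coeffU (bOfA (aDiag n)) * coeffV (Function.update (bOfA (aDiag n)) 1 (bOfA (aDiag n) 1 + 1)) -
                coeffU (Function.update (bOfA (aDiag n)) 1 (bOfA (aDiag n) 1 + 1)) * coeffV (bOfA (aDiag n))) : ℚ) : ℝ) *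
          zetaValue 2 -
        2 * ((rhoOf (aDiag n) *
              (coeffW (Function.update (bOfA (aDiag n)) 1 (bOfA (aDiag n) 1 + 1)) * coeffV (bOfA (aDiag n)) -
                coeffW (bOfA (aDiag n)) * coeffV (Function.update (bOfA (aDiag n)) 1 (bOfA (aDiag n) 1 + 1))) : ℚ) : ℝ) := by
  rw [update_bOfA_diag, bOfA_diag, QOf_diag, rhoOf_diag, cellularIntegral_diag_minors hrec hinit n]
  have hQ := congrArg (fun q : ℚ => (q : ℝ)) (bz_Q_ray n)
  push_cast at hQ ⊢
  linear_combination (-(2 * zetaValue 5 + 4 * zetaValue 3 * zetaValue 2)) * hQ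

/-- **The conclusion of `wedgeDictionary` on the whole diagonal** (`a = n·1⁸`, `j = 1`), both conjuncts, literally, for every `n`:
`Q(a) = ρ(a)(U(b)W(b′) − U(b′)W(b))` (unconditional, `wedgeDictionary_Q_diag`) and
`I(a) = 2ρ(a)·[(W(b′) − 2ζ(2)U(b′))·F̃₇(b) − (W(b) − 2ζ(2)U(b))·F̃₇(b′)]` (conditional on the two named facts of [BrownZudilin2022, Sect. 2];
`F̃₇ = vwpDual 7`, decomposed by the THEOREM `vwp_decomposition`). -/
theorem wedgeDictionary_diag (hrec : I_solvesRec) (hinit : I_init) (n : ℕ) :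
    (QOf (aDiag n) : ℚ) = rhoOf (aDiag n) *
        (coeffU (bOfA (aDiag n)) * coeffW (Function.update (bOfA (aDiag n)) 1 (bOfA (aDiag n) 1 + 1)) -
          coeffU (Function.update (bOfA (aDiag n)) 1 (bOfA (aDiag n) 1 + 1)) * coeffW (bOfA (aDiag n))) ∧
      cellularIntegral (aDiag n) =
        2 * (rhoOf (aDiag n) : ℝ) *
          (((coeffW (Function.update (bOfA (aDiag n)) 1 (bOfA (aDiag n) 1 + 1)) : ℝ) -
                2 * zetaValue 2 * coeffU (Function.update (bOfA (aDiag n)) 1 (bOfA (aDiag n) 1 + 1))) *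
              vwpDual 7 (bOfA (aDiag n)) -
            ((coeffW (bOfA (aDiag n)) : ℝ) - 2 * zetaValue 2 * coeffU (bOfA (aDiag n))) *
              vwpDual 7 (Function.update (bOfA (aDiag n)) 1 (bOfA (aDiag n) 1 + 1))) := by
  refine ⟨wedgeDictionary_Q_diag n, ?_⟩
  rw [update_bOfA_diag, bOfA_diag, rhoOf_diag, cellularIntegral_diag_minors hrec hinit n,
    (vwp_decomposition (bRay n) (inBox_bRay n) (sum_bRay_le n)).2,
    (vwp_decomposition (bRay' n) (box_bRay' n).1 (box_bRay' n).2).2]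
  push_cast
  ring

/-- The `I′`/`I″` reading on the diagonal: `I(n·1⁸) = 2·I′_n + 4ζ(2)·I″_n` with `I′_n = ρ_n(UW′ − U′W)ζ(5) − ρ_n(VW′ − V′W)` and
`I″_n = ρ_n(UW′ − U′W)ζ(3) − ρ_n(UV′ − U′V)` — i.e. `I′_n = Q_nζ(5) − P_n`, `I″_n = Q_nζ(3) − P̂_n` with all three coefficients the wedge
minors (conditional on the two named facts of [BrownZudilin2022, Sect. 2]). -/
theorem cellularIntegral_diag_forms (hrec : I_solvesRec) (hinit : I_init) (n : ℕ) :
    cellularIntegral (aDiag n) =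
      2 * (((-1) ^ n * (n.factorial : ℝ) ^ 10 / (4 * ((2 * n).factorial : ℝ))) *
            (((coeffU (bRay n) : ℝ) * coeffW (bRay' n) - coeffU (bRay' n) * coeffW (bRay n)) * zetaValue 5 -
              ((coeffV (bRay n) : ℝ) * coeffW (bRay' n) - coeffV (bRay' n) * coeffW (bRay n)))) +
        4 * zetaValue 2 * (((-1) ^ n * (n.factorial : ℝ) ^ 10 / (4 * ((2 * n).factorial : ℝ))) *
            (((coeffU (bRay n) : ℝ) * coeffW (bRay' n) - coeffU (bRay' n) * coeffW (bRay n)) * zetaValue 3 -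
              ((coeffU (bRay n) : ℝ) * coeffV (bRay' n) - coeffU (bRay' n) * coeffV (bRay n)))) := by
  rw [cellularIntegral_diag_minors hrec hinit n]; ring

/-! ### Every partner `j ∈ [1,7]` -/

/-- On the diagonal, moving the `+1` from slot `1` to slot `j` is the transposition `(1 j)` of the lower slots:
`bRay n + e_j = (1 j) • (bRay n + e₁)`. -/
theorem update_bRay_eq_permLower (n : ℕ) {j : ℕ} (hj1 : 1 ≤ j) (hj7 : j ≤ 7) :
    Function.update (bRay n) j (bRay n j + 1) = permLower (Equiv.swap (0 : Fin 7) ⟨j - 1, by omega⟩) (bRay' n) := by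
  funext k
  rcases Nat.lt_or_ge k 8 with hk | hk
  · interval_cases j <;> interval_cases k <;>
      simp [permLower, bRay', bRay, Equiv.swap_apply_def, Fin.ext_iff]
  · have h1 : ¬ (1 ≤ k ∧ k ≤ 7) := by omega
    have h2 : k ≠ j := by omega
    have h3 : k ≠ 1 := by omega
    simp [permLower, bRay', h1, h2, h3]

/-- `U(bRay n + e_j) = U(bRay n + e₁)` for `j ∈ [1,7]`. -/
theorem coeffU_update_bRay (n : ℕ) {j : ℕ} (hj1 : 1 ≤ j) (hj7 : j ≤ 7) :
    coeffU (Function.update (bRay n) j (bRay n j + 1)) = coeffU (bRay' n) := by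
  rw [update_bRay_eq_permLower n hj1 hj7, coeffU_permLower]

/-- `W(bRay n + e_j) = W(bRay n + e₁)` for `j ∈ [1,7]`. -/
theorem coeffW_update_bRay (n : ℕ) {j : ℕ} (hj1 : 1 ≤ j) (hj7 : j ≤ 7) :
    coeffW (Function.update (bRay n) j (bRay n j + 1)) = coeffW (bRay' n) := by
  rw [update_bRay_eq_permLower n hj1 hj7, coeffW_permLower]

/-- `V(bRay n + e_j) = V(bRay n + e₁)` for `j ∈ [1,7]`. -/
theorem coeffV_update_bRay (n : ℕ) {j : ℕ} (hj1 : 1 ≤ j) (hj7 : j ≤ 7) :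
    coeffV (Function.update (bRay n) j (bRay n j + 1)) = coeffV (bRay' n) := by
  rw [update_bRay_eq_permLower n hj1 hj7, coeffV_permLower]

/-- **The conclusion of `explicitPQ` on the whole diagonal, for every partner**: for all `n` and all `j ∈ [1,7]`, with `a = n·1⁸`,
`b = b(a)`, `b′ = b + e_j`:
`I(a) = Q(a)(2ζ(5) + 4ζ(3)ζ(2)) − 4ρ(a)(U(b)V(b′) − U(b′)V(b))ζ(2) − 2ρ(a)(W(b′)V(b) − W(b)V(b′))` — literally the conclusion of
`WedgeDictionary.explicitPQ` at `a = aDiag n` (all its hypotheses dropped), conditional on the two named facts of [BrownZudilin2022, Sect. 2]. -/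
theorem explicitPQ_diag_allj (hrec : I_solvesRec) (hinit : I_init) (n : ℕ) (j : ℕ) (hj : j ∈ Finset.Icc 1 7) :
    cellularIntegral (aDiag n) =
      (QOf (aDiag n) : ℝ) * (2 * zetaValue 5 + 4 * zetaValue 3 * zetaValue 2) -
        4 * ((rhoOf (aDiag n) *
              (coeffU (bOfA (aDiag n)) * coeffV (Function.update (bOfA (aDiag n)) j (bOfA (aDiag n) j + 1)) -
                coeffU (Function.update (bOfA (aDiag n)) j (bOfA (aDiag n) j + 1)) * coeffV (bOfA (aDiag n))) : ℚ) : ℝ) *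
          zetaValue 2 -
        2 * ((rhoOf (aDiag n) *
              (coeffW (Function.update (bOfA (aDiag n)) j (bOfA (aDiag n) j + 1)) * coeffV (bOfA (aDiag n)) -
                coeffW (bOfA (aDiag n)) * coeffV (Function.update (bOfA (aDiag n)) j (bOfA (aDiag n) j + 1))) : ℚ) : ℝ) := by
  rw [Finset.mem_Icc] at hj
  rw [bOfA_diag, coeffU_update_bRay n hj.1 hj.2, coeffW_update_bRay n hj.1 hj.2, coeffV_update_bRay n hj.1 hj.2,
    explicitPQ_diag hrec hinit n, update_bOfA_diag, bOfA_diag]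

/-- The same with the hypotheses of `explicitPQ` spelled out (they are not needed): the restriction of the conjecture
`WedgeDictionary.explicitPQ` to the diagonal `{n·1⁸}` follows from the two named facts of [BrownZudilin2022, Sect. 2]. -/
theorem explicitPQ_restricted_to_diag (hrec : I_solvesRec) (hinit : I_init) :
    ∀ (n : ℕ) (j : ℕ), j ∈ Finset.Icc 1 7 → BrownZudilin2022.Converges (aDiag n) →
      (∀ i ∈ Finset.Icc 1 7, 0 ≤ bOfA (aDiag n) i ∧ 2 * bOfA (aDiag n) i ≤ bOfA (aDiag n) 0 + 1) → 0 ≤ dOf (bOfA (aDiag n)) →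
      2 * (bOfA (aDiag n) j + 1) ≤ bOfA (aDiag n) 0 + 1 →
      cellularIntegral (aDiag n) =
        (QOf (aDiag n) : ℝ) * (2 * zetaValue 5 + 4 * zetaValue 3 * zetaValue 2) -
          4 * ((rhoOf (aDiag n) *
                (coeffU (bOfA (aDiag n)) * coeffV (Function.update (bOfA (aDiag n)) j (bOfA (aDiag n) j + 1)) -
                  coeffU (Function.update (bOfA (aDiag n)) j (bOfA (aDiag n) j + 1)) * coeffV (bOfA (aDiag n))) : ℚ) : ℝ) *
            zetaValue 2 -
          2 * ((rhoOf (aDiag n) *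
                (coeffW (Function.update (bOfA (aDiag n)) j (bOfA (aDiag n) j + 1)) * coeffV (bOfA (aDiag n)) -
                  coeffW (bOfA (aDiag n)) * coeffV (Function.update (bOfA (aDiag n)) j (bOfA (aDiag n) j + 1))) : ℚ) : ℝ) :=
  fun n j hj _ _ _ _ => explicitPQ_diag_allj hrec hinit n j hj

end Summit.KontsevichZagierPeriods.Zeta5Search.SymRay
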